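import Summits.QuantumAdvantage.AdviceFreeQNC0.WalkPhaseLaw
import HarnessLib

/-!
# Cell qa-qnc0 (rung F-Q1, route RingFrame, crux α `RingToElim`): transforms of low-degree
# `𝔽₂`-polynomials in the walk-character basis, and the far subcube around `alt`

Third layer of the `𝔽₄`-character toolkit (`WalkCharacters.lean`, `WalkExactLaw.lean`,
`WalkFailFloor.lean`, `WalkCharacterCoefficients.lean`, `WalkPhaseLaw.lean`; planner qa-qnc0-p1
TARGET §15.1), used by the interpolation theorem `WalkFailSetHits.lean` (TARGET §15.4(b)):

* `monoF_eq_ite`, `monoF_mul_monoF` — `u^S·u^T = u^{S∪T}`; **`polySpan_mul_fullSpan`** —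
  `𝔽₄[u]_{≤D'} · M_D(P) ⊆ M_{D'+D}(P)`;
* `algebraMap_mem_polySpan` — an `𝔽₂`-polynomial of degree `≤ D` read in `𝔽₄` lies in
  `polySpan m D`; `algebraMap_eq_tr_mul_of_vanish` — if `Q` vanishes on the fail set `{tr f ≠ 1}`
  then `Q = Q·[WIN] = tr(Q·f)` pointwise; hence **`Lfun_algebraMap_eq_zero_of_vanish`** (with the
  frequency vanishing `Lfun_tr_eq_zero_of_far`): `L_a(Q) = 0` at every pattern `a` far (with its
  conjugate) from the path at distance `> D' + D`;
* `Lfun_monoF` — `L_a(u^S) = Π_{i∉S} ω^{aᵢ}`; `twist`, **`twist_mul_Lfun_monoF`** — after the unit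
  twist `ω^{2a([m])}` this is the PRODUCT `Π_{i∈S} τ_a(i)`, `τ_a(i) = ω^{2aᵢ} ∈ {ω, ω²}`;
* `pdist_comm`, `pdist_triangle`, `pdist_flipOn_self`, `conj_flipOn`, **`far_flipOn_alt`** — for
  `|T| ≤ D'` and `m ≥ 2D + 4D' + 3` the flipped pattern `σ_T alt` and its conjugate are at
  distance `> D' + D` from every path pattern (closed forms `pdist_alt_aPat_eq`,
  `pdist_aPat_conjAlt` of `WalkPhaseLaw.lean`).

The cell's lemmas (prover qn-prover-3 gen 6), 2026-08-27; standard character calculus, not in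
print in this form.  WHAT THIS IS NOT: no statement about the game; no separation claim.
-/

noncomputable section

namespace Summit.QuantumAdvantage.AdviceFreeQNC0

open Finset
open Literature.Computability.MetaComplexity Literature.Computability.MetaComplexity.Smolensky
open F4

variable {m : ℕ}


/-! ### Monomials multiply; the full module is a module over the low-degree polynomials -/

/-- `u^S` is the indicator of `{u ⊇ S}`. -/
theorem monoF_eq_ite (S : Finset (Fin m)) (u : Fin m → Bool) :
    monoF S u = if (∀ i ∈ S, u i = true) then 1 else 0 := by
  classical
  unfold monoF ιF
  rw [Finset.prod_boole]
  congr 1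

/-- `u^S · u^T = u^{S ∪ T}` on the cube. -/
theorem monoF_mul_monoF (S T : Finset (Fin m)) (u : Fin m → Bool) :
    monoF S u * monoF T u = monoF (S ∪ T) u := by
  classical
  rw [monoF_eq_ite, monoF_eq_ite, monoF_eq_ite]
  by_cases hS : ∀ i ∈ S, u i = true <;> by_cases hT : ∀ i ∈ T, u i = true
  · rw [if_pos hS, if_pos hT, if_pos (Finset.forall_mem_union.2 ⟨hS, hT⟩), one_mul]
  · rw [if_neg hT, mul_zero, if_neg fun h => hT (Finset.forall_mem_union.1 h).2]
  · rw [if_neg hS, zero_mul, if_neg fun h => hS (Finset.forall_mem_union.1 h).1]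
  · rw [if_neg hS, zero_mul, if_neg fun h => hS (Finset.forall_mem_union.1 h).1]

/-- **`𝔽₄[u]_{≤D'} · M_D(P) ⊆ M_{D'+D}(P)`**: multiplying a full strategy by a polynomial of degree
`≤ D'` raises the degree budget by `D'`. -/
theorem polySpan_mul_fullSpan {D D' : ℕ} {h f : (Fin m → Bool) → F4} (hh : h ∈ polySpan m D')
    (hf : f ∈ fullSpan m D) : (fun u => h u * f u) ∈ fullSpan m (D' + D) := by
  classical
  -- first a single monomial `u^S`, by span induction on `f`
  have step : ∀ S : Finset (Fin m), S.card ≤ D' → ∀ f : (Fin m → Bool) → F4, f ∈ fullSpan m D →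
      (fun u => monoF S u * f u) ∈ fullSpan m (D' + D) := by
    intro S hS f hf
    unfold fullSpan at hf
    induction hf using Submodule.span_induction with
    | mem G hG =>
      obtain ⟨g, T, hT, rfl⟩ := hG
      have e : (fun u => monoF S u * (fun u => monoF T u * chi (aPat g) u) u) =
          fun u => monoF (S ∪ T) u * chi (aPat g) u := by
        funext u
        rw [← monoF_mul_monoF, mul_assoc]
      rw [e]
      exact Submodule.subset_span ⟨g, S ∪ T,
        (Finset.card_union_le S T).trans (Nat.add_le_add hS hT), rfl⟩
    | zero =>
      have e : (fun u : Fin m → Bool => monoF S u * (0 : (Fin m → Bool) → F4) u) = 0 := by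
        funext u; simp
      rw [e]; exact Submodule.zero_mem _
    | add G H _ _ hG hH =>
      have e : (fun u => monoF S u * (G + H) u) =
          (fun u => monoF S u * G u) + fun u => monoF S u * H u := by
        funext u; simp [mul_add]
      rw [e]; exact Submodule.add_mem _ hG hH
    | smul r G _ hG =>
      have e : (fun u => monoF S u * (r • G) u) = r • fun u => monoF S u * G u := by
        funext u; simp [smul_eq_mul]; ring
      rw [e]; exact Submodule.smul_mem _ _ hG
  -- then span induction on `h`
  unfold polySpan at hh
  induction hh using Submodule.span_induction with
  | mem G hG =>
    obtain ⟨S, hS, rfl⟩ := hG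
    exact step S hS f hf
  | zero =>
    have e : (fun u : Fin m → Bool => (0 : (Fin m → Bool) → F4) u * f u) = 0 := by
      funext u; simp
    rw [e]; exact Submodule.zero_mem _
  | add G H _ _ hG hH =>
    have e : (fun u => (G + H) u * f u) = (fun u => G u * f u) + fun u => H u * f u := by
      funext u; simp [add_mul]
    rw [e]; exact Submodule.add_mem _ hG hH
  | smul r G _ hG =>
    have e : (fun u => (r • G) u * f u) = r • fun u => G u * f u := by
      funext u; simp [smul_eq_mul, mul_assoc]
    rw [e]; exact Submodule.smul_mem _ _ hG

/-! ### An `𝔽₂`-polynomial vanishing on the fail set is reproduced by the strategy -/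

/-- The transfer `𝔽₂ → 𝔽₄` of the degree filtration: `Q ∈ 𝔽₂[u]_{≤D}` read in `𝔽₄` lies in
`polySpan m D`. -/
theorem algebraMap_mem_polySpan {D : ℕ} {Q : CubeFn (ZMod 2) m} (hQ : Q ∈ lowDeg (ZMod 2) m D) :
    (fun u => algebraMap (ZMod 2) F4 (Q u)) ∈ polySpan m D := by
  classical
  rw [lowDeg_eq_span] at hQ
  induction hQ using Submodule.span_induction with
  | mem G hG =>
    obtain ⟨⟨S, hS⟩, rfl⟩ := hG
    have e : (fun u => algebraMap (ZMod 2) F4 (mono (ZMod 2) S u)) = monoF S := by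
      funext u
      unfold mono monoF ιF
      rw [map_prod]
      refine Finset.prod_congr rfl fun i _ => ?_
      by_cases h : u i = true <;> simp [h]
    rw [e]
    exact Submodule.subset_span ⟨S, hS, rfl⟩
  | zero =>
    have e : (fun u : Fin m → Bool => algebraMap (ZMod 2) F4 ((0 : CubeFn (ZMod 2) m) u)) = 0 := by
      funext u; simp
    rw [e]; exact Submodule.zero_mem _
  | add G H _ _ hG hH =>
    have e : (fun u => algebraMap (ZMod 2) F4 ((G + H) u)) =
        (fun u => algebraMap (ZMod 2) F4 (G u)) + fun u => algebraMap (ZMod 2) F4 (H u) := by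
      funext u; simp
    rw [e]; exact Submodule.add_mem _ hG hH
  | smul r G _ hG =>
    have e : (fun u => algebraMap (ZMod 2) F4 ((r • G) u)) =
        algebraMap (ZMod 2) F4 r • fun u => algebraMap (ZMod 2) F4 (G u) := by
      funext u; simp [smul_eq_mul]
    rw [e]; exact Submodule.smul_mem _ _ hG

/-- The two elements of `𝔽₂`. -/
private theorem zmod2_eq_zero_or_one (s : ZMod 2) : s = 0 ∨ s = 1 := by
  fin_cases s
  · exact Or.inl rfl
  · exact Or.inr rfl

/-- **Hitting turned into an identity**: if the `𝔽₂`-polynomial `Q` vanishes wherever the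
strategy `f` fails (`tr f ≠ 1`), then `Q = Q · [WIN] = tr(Q · f)` pointwise. -/
theorem algebraMap_eq_tr_mul_of_vanish {f : (Fin m → Bool) → F4} {Q : CubeFn (ZMod 2) m}
    (hvan : ∀ u, tr (f u) ≠ 1 → Q u = 0) :
    (fun u => tr (algebraMap (ZMod 2) F4 (Q u) * f u)) = fun u => algebraMap (ZMod 2) F4 (Q u) := by
  funext u
  rcases zmod2_eq_zero_or_one (Q u) with h0 | h1
  · rw [h0, map_zero, zero_mul, tr_zero]
  · by_cases htr : tr (f u) = 1
    · rw [h1, map_one, one_mul, htr]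
    · exact absurd (hvan u htr) (by rw [h1]; exact one_ne_zero)

/-- **No far frequencies in a vanishing polynomial**: for `f ∈ M_D(P)` and `Q` of `𝔽₂`-degree
`≤ D'` vanishing on the fail set of `f`, `L_a(Q) = 0` at every pattern `a` with `a` and `ā` at
distance `> D' + D` from the path. -/
theorem Lfun_algebraMap_eq_zero_of_vanish {D D' : ℕ} {f : (Fin m → Bool) → F4}
    (hf : f ∈ fullSpan m D) {Q : CubeFn (ZMod 2) m} (hQ : Q ∈ lowDeg (ZMod 2) m D')
    (hvan : ∀ u, tr (f u) ≠ 1 → Q u = 0) {a : Fin m → Bool} (ha : ¬ NearPath (D' + D) a)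
    (ha' : ¬ NearPath (D' + D) (conj a)) :
    Lfun a (fun u => algebraMap (ZMod 2) F4 (Q u)) = 0 := by
  rw [← algebraMap_eq_tr_mul_of_vanish hvan]
  exact Lfun_tr_eq_zero_of_far (polySpan_mul_fullSpan (algebraMap_mem_polySpan hQ) hf) ha ha'

/-! ### The twisted transform of a monomial -/

/-- `L_a(u^S) = Π_{i ∉ S} ω^{aᵢ}`. -/
theorem Lfun_monoF (a : Fin m → Bool) (S : Finset (Fin m)) :
    Lfun a (monoF S) = ω ^ lettSum (univ \ S) a := by
  classical
  unfold Lfun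
  have e : ∀ u : Fin m → Bool, monoF S u * ∏ i, (if u i = true then (1 : F4) else ω ^ lett (!a i)) =
      ∏ i, ((if i ∈ S then ιF (u i) else 1) * (if u i = true then (1 : F4) else ω ^ lett (!a i))) := by
    intro u
    rw [Finset.prod_mul_distrib]
    congr 1
    unfold monoF
    rw [← Finset.prod_filter, Finset.filter_mem_eq_inter, Finset.univ_inter]
  rw [Finset.sum_congr rfl fun u _ => e u]
  have h := Finset.prod_univ_sum (fun _ : Fin m => (univ : Finset Bool))
    (fun i bb => (if i ∈ S then ιF bb else 1) * (if bb = true then (1 : F4) else ω ^ lett (!a i)))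
  rw [Fintype.piFinset_univ] at h
  rw [← h]
  have hfac : ∀ i : Fin m,
      (∑ bb : Bool, (if i ∈ S then ιF bb else 1) * (if bb = true then (1 : F4) else ω ^ lett (!a i))) =
        if i ∈ univ \ S then ω ^ lett (a i) else 1 := by
    intro i
    rw [Fintype.sum_bool]
    simp only [Finset.mem_sdiff, Finset.mem_univ, true_and, if_true, Bool.false_eq_true, if_false]
    unfold ιF lett
    by_cases hi : i ∈ S
    · simp [hi]
    · simp only [hi, if_false, one_mul, not_false_eq_true, if_true]
      cases a i
      · simp only [Bool.not_false, if_true, Bool.false_eq_true, if_false, pow_one]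
        exact one_add_omega_sq
      · simp only [Bool.not_true, Bool.false_eq_true, if_false, if_true, pow_one]
        exact one_add_omega
  rw [Finset.prod_congr rfl fun i _ => hfac i, Finset.prod_ite, Finset.prod_const_one, mul_one,
    Finset.filter_mem_eq_inter, Finset.univ_inter]
  unfold lettSum
  rw [Finset.prod_pow_eq_pow_sum]

/-- The twist `τ_a(i) = ω^{2aᵢ} ∈ {ω², ω}`. -/
def twist (a : Fin m → Bool) (i : Fin m) : F4 := ω ^ (2 * lett (a i))

/-- **The twisted transform of a monomial is a product**: `ω^{2a([m])} · L_a(u^S) = Π_{i∈S} τ_a(i)`. -/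
theorem twist_mul_Lfun_monoF (a : Fin m → Bool) (S : Finset (Fin m)) :
    ω ^ (2 * lettSum univ a) * Lfun a (monoF S) = ∏ i ∈ S, twist a i := by
  classical
  rw [Lfun_monoF, ← pow_add]
  unfold twist
  rw [Finset.prod_pow_eq_pow_sum, ← Finset.mul_sum, omega_pow_mod,
    omega_pow_mod (2 * ∑ i ∈ S, lett (a i))]
  congr 1
  have hsplit : lettSum univ a = lettSum S a + lettSum (univ \ S) a := by
    unfold lettSum
    rw [← Finset.sum_union (Finset.disjoint_sdiff), Finset.union_sdiff_of_subset (Finset.subset_univ S)]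
  unfold lettSum at hsplit ⊢
  omega

/-! ### Distances: the subcube around `alt` is far from the path -/

/-- Hamming distance is symmetric. -/
theorem pdist_comm (a b : Fin m → Bool) : pdist a b = pdist b a := by
  unfold pdist
  congr 1
  exact Finset.filter_congr fun i _ => ne_comm

/-- Triangle inequality for the Hamming distance of patterns. -/
theorem pdist_triangle (a b c : Fin m → Bool) : pdist a c ≤ pdist a b + pdist b c := by
  classical
  unfold pdist
  rw [← Finset.card_union_add_card_inter]
  refine le_trans (Finset.card_le_card fun i hi => ?_) (Nat.le_add_right _ _)
  rw [Finset.mem_filter] at hi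
  rw [Finset.mem_union, Finset.mem_filter, Finset.mem_filter]
  by_cases h : a i = b i
  · right; exact ⟨Finset.mem_univ _, by rw [← h]; exact hi.2⟩
  · left; exact ⟨Finset.mem_univ _, h⟩

/-- Flipping on `T` moves a pattern by `|T|`. -/
theorem pdist_flipOn_self (T : Finset (Fin m)) (a : Fin m → Bool) : pdist a (flipOn T a) = T.card := by
  rw [← card_misSet, ← (flipOn_eq_iff T a (flipOn T a)).1 rfl]

/-- Conjugation commutes with flips. -/
theorem conj_flipOn (T : Finset (Fin m)) (a : Fin m → Bool) : conj (flipOn T a) = flipOn T (conj a) := by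
  funext i
  unfold conj flipOn
  by_cases h : i ∈ T <;> simp [h]

/-- **The subcube around `alt` is far**: on `m ≥ 2D + 4D' + 3` letters, for `|T| ≤ D'` the pattern
`σ_T alt` and its conjugate are at distance `> D' + D` from every path pattern. -/
theorem far_flipOn_alt {D D' : ℕ} (hm : 2 * D + 4 * D' + 3 ≤ m) {T : Finset (Fin m)} (hT : T.card ≤ D') :
    ¬ NearPath (D' + D) (flipOn T (alt : Fin m → Bool)) ∧
      ¬ NearPath (D' + D) (conj (flipOn T (alt : Fin m → Bool))) := by
  constructor
  · rintro ⟨g, hg⟩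
    have h1 := pdist_alt_aPat_eq m g
    have h2 := pdist_triangle (alt : Fin m → Bool) (flipOn T alt) (aPat g)
    rw [pdist_flipOn_self] at h2
    omega
  · rintro ⟨g, hg⟩
    rw [conj_flipOn] at hg
    have h1 := pdist_aPat_conjAlt m g
    rw [pdist_comm] at h1
    have h2 := pdist_triangle (conj (alt : Fin m → Bool)) (flipOn T (conj alt)) (aPat g)
    rw [pdist_flipOn_self] at h2
    omega

end Summit.QuantumAdvantage.AdviceFreeQNC0

end
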